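import Summits.AtomisticToContinuum.HydrodynamicLimit.Theses.LambertianContactSwap
import Summits.AtomisticToContinuum.HydrodynamicLimit.Theorems.LambertianContactSwapSwapGapStubFieldConcentrationStatic
import Summits.AtomisticToContinuum.HydrodynamicLimit.Theorems.LambertianContactSwapSwapGapRelEntSwapTimeZero
import Summits.AtomisticToContinuum.HydrodynamicLimit.Theorems.LambertianContactSwapSwapGapEntropyTransfer
import Literature.MathematicalPhysics.KineticTheory.LambertianHardSphereFlow
import HarnessLib

/-!
# `SwapGap` (stmt-AtomisticToContinuum-11850), line `Sketch`: rung R3 — the research stub S2 HOLDS at `t = 0`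

Helper file (`--supports stmt-AtomisticToContinuum-11850`) of line `Sketch` (card
`entropy-relative-to-lambertian-law`) for the crux
`Summit.AtomisticToContinuum.HydrodynamicLimit.Theses.LambertianContactSwap.SwapGap`, registered helper
stub `stub_fieldConcentration_zero` (rung R3) of the lead's skeleton v7 — it is c0's registered
sub-goal `fieldConcentration_lambertFlow_zero`, whose cycle-1 proof never reached the tree.

The research stub S2 (`stub_fieldConcentration`) asks for speed-`N + 1` self-averaging of every bounded
`1`-Lipschitz statistic `F` of the `χ`-tested field triple of the Lambertian flow `Λ_t` around its
own mean under `P_N ⊗ γ^ℕ`, `P_N = localGibbsLaw σ a₀ u₀ θ₀ N (Φ N)`. At `t = 0` the Lambertian flow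
is the identity almost surely (`P_N ≪ Liouville` as a `withDensity` law, `ae_lambertFlow_zero_eq`), so
the law of `Λ_0` under `P_N ⊗ γ^ℕ` is `P_N` itself (`map_lambertFlow_zero_prod`, p106360): both the
mean and the deviation event are the STATIC ones, and rung R0 (`stub_fieldConcentration_static`,
p124393: static exponential concentration under local Gibbs laws, uniformly in `N` and in the flow)
closes the rung with `σ₀ := min (1/2) σ₁` (`σ < 1/2` makes `P_N` a probability measure and `Λ`
jointly measurable).

prover-line-stmt-AtomisticToContinuum-11850-c3-0, wave 6.
-/

noncomputable section

open MeasureTheory Filter Set Topology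
open scoped ENNReal

namespace Summit.AtomisticToContinuum.HydrodynamicLimit.Theorems

open Literature.Analysis.FluidPDE Literature.MathematicalPhysics.KineticTheory

/-- **R3 · THE `t = 0` INSTANCE OF S2.** For continuous profiles `a₀, θ₀ > 0`, `u₀` there is
`σ₀ > 0` such that for `0 < σ < σ₀`, all flows `Φ`, every continuous `χ`, every `1`-Lipschitz `F`
bounded by `1` and every `δ > 0` there is `C > 0` with
`(P_N ⊗ γ^ℕ){δ < |F(fld(Λ_0, χ)) − ∫ F(fld(Λ_0, χ)) d(P_N ⊗ γ^ℕ)|} ≤ C e^{−(N+1)/C}` for all `N`.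
Proof: `(Λ_0)_* (P_N ⊗ γ^ℕ) = P_N` (`map_lambertFlow_zero_prod`, with `P_N ≪ Liouville` by
`particleLaw_eq`/`withDensity_absolutelyContinuous` and `0 < hsDiameter σ N ≤ σ < 1/2`), so the mean is
the static mean (`integral_map`) and the event has the static probability (`Measure.map_apply`); then
`stub_fieldConcentration_static`. [folklore] -/
theorem stub_fieldConcentration_zero :
    ∀ (a₀ θ₀ : T3 → ℝ) (u₀ : T3 → V3), Continuous a₀ → Continuous θ₀ → Continuous u₀ →
      (∀ x, 0 < a₀ x) → (∀ x, 0 < θ₀ x) →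
      ∃ σ₀ : ℝ, 0 < σ₀ ∧ ∀ σ : ℝ, 0 < σ → σ < σ₀ →
        ∀ Φ : (N : ℕ) → HardSphereFlow (Torus.geometry (Fin 3)) (hsDiameter σ N) (N + 1),
          ∀ χ : T3 → ℝ, Continuous χ → ∀ F : ℝ × V3 × ℝ → ℝ, LipschitzWith 1 F → (∀ y, |F y| ≤ 1) →
            ∀ δ : ℝ, 0 < δ → ∃ C : ℝ, 0 < C ∧ ∀ N : ℕ,
              ((localGibbsLaw σ a₀ u₀ θ₀ N (Φ N)).prod (lambertNoise (Fin 3)))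
                  {p | δ < |F (empiricalDensityField
                          (lambertFlow (Torus.geometry (Fin 3)) (hsDiameter σ N) p.2 p.1 0) χ,
                        empiricalMomentumField
                          (lambertFlow (Torus.geometry (Fin 3)) (hsDiameter σ N) p.2 p.1 0) χ,
                        empiricalEnergyField
                          (lambertFlow (Torus.geometry (Fin 3)) (hsDiameter σ N) p.2 p.1 0) χ) -
                      ∫ q, F (empiricalDensityField
                          (lambertFlow (Torus.geometry (Fin 3)) (hsDiameter σ N) q.2 q.1 0) χ,
                        empiricalMomentumField
                          (lambertFlow (Torus.geometry (Fin 3)) (hsDiameter σ N) q.2 q.1 0) χ,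
                        empiricalEnergyField
                          (lambertFlow (Torus.geometry (Fin 3)) (hsDiameter σ N) q.2 q.1 0) χ)
                        ∂((localGibbsLaw σ a₀ u₀ θ₀ N (Φ N)).prod (lambertNoise (Fin 3)))|} ≤
                ENNReal.ofReal (C * Real.exp (-(C⁻¹ * ((N : ℝ) + 1)))) := by
  intro a₀ θ₀ u₀ ha hθ hu ha0 hθ0
  obtain ⟨σ₁, hσ₁, hstat⟩ := stub_fieldConcentration_static a₀ θ₀ u₀ ha hθ hu ha0 hθ0
  refine ⟨min 2⁻¹ σ₁, lt_min (by norm_num) hσ₁, ?_⟩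
  intro σ hσ hσlt Φ χ hχ F hF hF1 δ hδ
  have hσhalf : σ < 2⁻¹ := hσlt.trans_le (min_le_left _ _)
  have hσσ₁ : σ < σ₁ := hσlt.trans_le (min_le_right _ _)
  -- the static constant, uniform in `N` and in the flow
  obtain ⟨C, hC, hCN⟩ := hstat σ hσ hσσ₁ χ hχ F hF hF1 δ hδ
  refine ⟨C, hC, fun N => ?_⟩
  -- notation
  set P : Measure (Config (N + 1) (Fin 3) T3) := localGibbsLaw σ a₀ u₀ θ₀ N (Φ N) with hPdef
  set Λ : Config (N + 1) (Fin 3) T3 × (ℕ → EuclideanSpace ℝ (Fin 3)) → Config (N + 1) (Fin 3) T3 :=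
    fun p => lambertFlow (Torus.geometry (Fin 3)) (hsDiameter σ N) p.2 p.1 0 with hΛdef
  set G : Config (N + 1) (Fin 3) T3 → ℝ := fun z =>
    F (empiricalDensityField z χ, empiricalMomentumField z χ, empiricalEnergyField z χ) with hGdef
  haveI hPprob : IsProbabilityMeasure P :=
    isProbabilityMeasure_localGibbsLaw ha hθ hu ha0 hθ0 (σ := σ) (by linarith) N (Φ N)
  -- `P ≪ Liouville`, `0 < ε < 1/2`
  have hPac : P ≪ liouville (Torus.geometry (Fin 3)) (N + 1) (hsDiameter σ N) := by
    rw [hPdef, localGibbsLaw, particleLaw_eq]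
    exact withDensity_absolutelyContinuous _ _
  have hε : 0 < hsDiameter σ N := hsDiameter_pos hσ N
  have hε' : hsDiameter σ N < 2⁻¹ := (hsDiameter_le hσ.le N).trans_lt hσhalf
  -- `(Λ_0)_* (P ⊗ γ^ℕ) = P`
  have hid : (P.prod (lambertNoise (Fin 3))).map Λ = P := map_lambertFlow_zero_prod hε hε' P hPac
  -- measurability
  have hΛ : Measurable Λ := measurable_lambertFlow_hsDiameter hσ.le hσhalf N 0
  have hGm : Measurable G := hF.continuous.measurable.comp (measurable_fieldTriple hχ)
  -- the Lambertian mean at `t = 0` is the static mean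
  have hmean : ∫ q, G (Λ q) ∂(P.prod (lambertNoise (Fin 3))) = ∫ w, G w ∂P := by
    rw [← integral_map hΛ.aemeasurable hGm.aestronglyMeasurable, hid]
  -- the deviation event at `t = 0` has the static probability
  have hAm : MeasurableSet {z | δ < |G z - ∫ w, G w ∂P|} :=
    measurableSet_lt measurable_const (hGm.sub measurable_const).abs
  have hev : (P.prod (lambertNoise (Fin 3))) {p | δ < |G (Λ p) - ∫ w, G w ∂P|} =
      P {z | δ < |G z - ∫ w, G w ∂P|} := by
    have h := Measure.map_apply (μ := P.prod (lambertNoise (Fin 3))) hΛ hAm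
    rw [hid] at h
    exact h.symm
  show (P.prod (lambertNoise (Fin 3))) {p | δ < |G (Λ p) - ∫ q, G (Λ q) ∂(P.prod (lambertNoise (Fin 3)))|} ≤
    ENNReal.ofReal (C * Real.exp (-(C⁻¹ * ((N : ℝ) + 1))))
  rw [hmean, hev]
  exact hCN N (Φ N)

end Summit.AtomisticToContinuum.HydrodynamicLimit.Theorems
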